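import Literature.NumberTheory.Sieve.Maynard2016Prop92MainDecomposition
import Literature.NumberTheory.Sieve.FGKMT2018QuadFormSwap
import Literature.NumberTheory.Sieve.FGKMT2018LocalPairSumPeel
import Literature.NumberTheory.Sieve.Maynard2016Lemma85LamBound
import HarnessLib

/-!
# Maynard 2016, Proposition 9.2 for `𝒜 = ℤ` — the change of variables `y^{(m)}` (displays (9.10)–(9.11))

Sources: J. Maynard, *Dense clusters of primes in subsets*, Compositio Math. 152 (2016) 1517–1554 =
arXiv:1405.2593 [Maynard2016DenseClusters], proof of Proposition 9.2, p. 21 (displays (9.9)–(9.11));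
K. Ford, B. Green, S. Konyagin, J. Maynard, T. Tao, *Long gaps between primes*, JAMS 31 (2018)
[FordGreenKonyaginMaynardTao2018], Theorem 6 (7.13).

First step (S) of the exact-algebra leaf `Maynard2016Prop92Regroup` (M1) of
`Maynard2016Prop92MainDecomposition`: the `φ_L`-twisted twin of `FGKMT2018QuadFormSwap`.
Unlike (8.6)/(9.2), where `λ_d` is *defined* from `y_r`, the variables `y^{(m)}_r` of (9.10) are
defined from `λ_d`, so the substitution «`λ_d = μ(d) φ_L(d) ∑_{r : d ∣ r} y^{(m)}_r/φ_ω(r)`» is a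
genuine Möbius inversion on the box `𝒟'_k ∩ {d_m = 1}` (`dkBoxP`), proved here:

* `mem_dkBoxP_of_dvd` — `dkBoxP` is closed under coordinatewise divisors;
* `sum_moebius_interval_eq` — for `e ∈ dkBoxP` and any `d`,
  `∑_{r ∈ dkBoxP, d ∣ r ∣ e} μ(∏ rᵢ) = [d = e] μ(∏ eᵢ)` (sign-reversing involution `r_j ↦ r_j p^{±1}`);
* `lamVar_div_totForm_eq` — **the inversion of (9.10)**: for `d ∈ dkBoxP` (admissible `𝓛`),
  `λ_d/φ_L(d) = μ(d) ∑_{r ∈ dkBoxP, d ∣ r} y^{(m)}_r/φ_ω(r)`;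
* `primeQF_eq_sum_yVarM` — **display (9.11)**:
  `Q_m = ∑'_{d,e} λ_d λ_e/φ_L([d,e]) = ∑_{r,s ∈ dkBoxP} (y^{(m)}_r y^{(m)}_s/(φ_ω(r)φ_ω(s))) T^{(m)}(r,s)`
  with `T^{(m)} = localPairSumM`.

## References
* J. Maynard, *Dense clusters of primes in subsets*, Compositio Math. 152 (2016), proof of Prop. 9.2
  p. 21, (9.9)–(9.11) [Maynard2016DenseClusters].
* K. Ford, B. Green, S. Konyagin, J. Maynard, T. Tao, *Long gaps between primes*, JAMS 31 (2018),
  Thm 6 (7.13) [FordGreenKonyaginMaynardTao2018].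
-/

noncomputable section

open Finset
open scoped ArithmeticFunction.Moebius

namespace Literature.NumberTheory.Sieve.FGKMT2018

variable {k : ℕ}

/-! ### `dkBoxP` is divisor-closed -/

/-- `𝒟'_k ∩ {d_m = 1}` is closed under coordinatewise divisors.
[cite: Maynard2016DenseClusters, proof of Prop. 9.2 p. 21 (the sums «d ∣ r» in (9.10)); §6 p. 11 (𝒟'_k)] -/
theorem mem_dkBoxP_of_dvd {L : Fin k → ℤ × ℤ} {B : ℕ} {R : ℝ} {m : Fin k} {r d : Fin k → ℕ}
    (hr : r ∈ dkBoxP L B R m) (hd : ∀ i, d i ∣ r i) : d ∈ dkBoxP L B R m := by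
  rw [mem_dkBoxP_iff] at hr ⊢
  obtain ⟨hrbox, hrm, hrcop⟩ := hr
  refine ⟨mem_dkBox_of_dvd hrbox hd, Nat.dvd_one.1 (hrm ▸ hd m), fun j hj =>
    (hrcop j hj).coprime_dvd_left (hd j)⟩

/-- For `r ∈ dkBoxP`: `{d ∈ dkBoxP : dᵢ ∣ rᵢ ∀ i} = ∏ᵢ divisors(rᵢ)`.
[cite: Maynard2016DenseClusters, proof of Prop. 9.2 p. 21, (9.10)] -/
theorem filter_dvd_dkBoxP_eq_piFinset_divisors {L : Fin k → ℤ × ℤ} {B : ℕ} {R : ℝ} {m : Fin k}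
    {r : Fin k → ℕ} (hr : r ∈ dkBoxP L B R m) :
    (dkBoxP L B R m).filter (fun d => ∀ i, d i ∣ r i) = Fintype.piFinset fun i => (r i).divisors := by
  classical
  ext d
  simp only [Finset.mem_filter, Fintype.mem_piFinset, Nat.mem_divisors]
  constructor
  · rintro ⟨-, hd⟩ i
    exact ⟨hd i, Nat.one_le_iff_ne_zero.1 (one_le_of_mem_dkBox (dkBoxP_subset L B R m hr) i)⟩
  · intro h
    exact ⟨mem_dkBoxP_of_dvd hr fun i => (h i).1, fun i => (h i).1⟩

/-! ### Möbius on an interval of the box -/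

/-- **Möbius function of an interval**: for `e ∈ dkBoxP` and any `d`,
`∑_{r ∈ dkBoxP, d ∣ r ∣ e} μ(∏ rᵢ) = μ(∏ eᵢ)` if `d = e` and `0` otherwise (if `d ≠ e` either the
interval is empty or some prime `p ∣ e_j`, `p ∤ d_j` toggles: `r_j ↦ r_j p^{±1}`).
[cite: Maynard2016DenseClusters, proof of Prop. 9.2 p. 21 (inversion of (9.10), «substituting this in (9.9)»)] -/
theorem sum_moebius_interval_eq {L : Fin k → ℤ × ℤ} {B : ℕ} {R : ℝ} {m : Fin k}
    {e : Fin k → ℕ} (he : e ∈ dkBoxP L B R m) (d : Fin k → ℕ) :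
    ∑ r ∈ (dkBoxP L B R m).filter (fun r => (∀ i, d i ∣ r i) ∧ ∀ i, r i ∣ e i),
        ((μ (∏ i, r i) : ℤ) : ℝ) = if d = e then ((μ (∏ i, e i) : ℤ) : ℝ) else 0 := by
  classical
  have hebox := dkBoxP_subset L B R m he
  split_ifs with hdeq
  · subst hdeq
    have hS : (dkBoxP L B R m).filter (fun r => (∀ i, d i ∣ r i) ∧ ∀ i, r i ∣ d i) = {d} := by
      ext r
      simp only [Finset.mem_filter, Finset.mem_singleton]
      constructor
      · rintro ⟨-, h1, h2⟩; funext i; exact Nat.dvd_antisymm (h2 i) (h1 i)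
      · rintro rfl; exact ⟨he, fun i => dvd_rfl, fun i => dvd_rfl⟩
    rw [hS, Finset.sum_singleton]
  · by_cases hde : ∀ i, d i ∣ e i
    swap
    · refine Finset.sum_eq_zero fun r hr => ?_
      obtain ⟨-, h1, h2⟩ := Finset.mem_filter.1 hr
      exact absurd (fun i => (h1 i).trans (h2 i)) hde
    obtain ⟨j, hj⟩ : ∃ j, d j ≠ e j := by
      by_contra h
      exact hdeq (funext fun i => not_not.1 fun hi => h ⟨i, hi⟩)
    have hesq : Squarefree (e j) := squarefree_apply_of_mem_dkBox hebox j
    have he1 : 1 ≤ e j := one_le_of_mem_dkBox hebox j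
    obtain ⟨c, hc⟩ := hde j
    have hc1 : c ≠ 1 := fun h => hj (by rw [hc, h, mul_one])
    obtain ⟨p, hp, hpc⟩ := Nat.exists_prime_and_dvd hc1
    have hpe : p ∣ e j := hc ▸ dvd_mul_of_dvd_right hpc (d j)
    have hpd : ¬ p ∣ d j := fun h => hp.not_isUnit (hesq p (hc ▸ mul_dvd_mul h hpc))
    -- no other coordinate of a divisor of `e` is divisible by `p`
    have hother : ∀ r : Fin k → ℕ, (∀ i, r i ∣ e i) → ∀ i, i ≠ j → ¬ p ∣ r i := by
      intro r hre i hij h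
      have hg := Nat.dvd_gcd (h.trans (hre i)) hpe
      rw [(coprime_apply_of_mem_dkBox hebox hij).gcd_eq_one] at hg
      exact hp.one_lt.ne' (Nat.dvd_one.1 hg)
    have hndiv : ∀ r : Fin k → ℕ, (∀ i, r i ∣ e i) → p ∣ r j → ¬ p ∣ r j / p := by
      intro r hre hpr h
      rw [Nat.dvd_div_iff_mul_dvd hpr] at h
      exact hp.not_isUnit ((hesq.squarefree_of_dvd (hre j)) p h)
    refine Finset.sum_involution
      (fun r _ => Function.update r j (if p ∣ r j then r j / p else r j * p)) ?_ ?_ ?_ ?_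
    · -- cancellation: `μ` flips
      intro r hr
      obtain ⟨-, -, hre⟩ := Finset.mem_filter.1 hr
      by_cases hpr : p ∣ r j
      · have h := moebius_prod_update_mul (Function.update r j (r j / p)) j hp (fun i => by
          by_cases hi : i = j
          · subst hi; rw [Function.update_self]; exact hndiv r hre hpr
          · rw [Function.update_of_ne hi]; exact hother r hre i hi)
        rw [Function.update_idem, Function.update_self, Nat.div_mul_cancel hpr,
          Function.update_eq_self] at h
        simp only [if_pos hpr]
        rw [h]; push_cast; ring
      · have h := moebius_prod_update_mul r j hp (fun i => by
          by_cases hi : i = j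
          · subst hi; exact hpr
          · exact hother r hre i hi)
        simp only [if_neg hpr]
        rw [h]; push_cast; ring
    · -- the toggle moves every point
      intro r hr _ h
      obtain ⟨-, -, hre⟩ := Finset.mem_filter.1 hr
      have hjv := congr_fun h j
      simp only [Function.update_self] at hjv
      have hr1 : 1 ≤ r j := Nat.pos_of_dvd_of_pos (hre j) he1
      split_ifs at hjv with hpr
      · exact (Nat.div_lt_self hr1 hp.one_lt).ne hjv
      · have : r j * p = r j * 1 := by rw [hjv, mul_one]
        exact hp.one_lt.ne' (Nat.eq_of_mul_eq_mul_left hr1 this)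
    · -- membership
      intro r hr
      obtain ⟨-, hdr, hre⟩ := Finset.mem_filter.1 hr
      have htre : ∀ i, Function.update r j (if p ∣ r j then r j / p else r j * p) i ∣ e i := by
        intro i
        by_cases hi : i = j
        · subst hi
          rw [Function.update_self]
          split_ifs with hpr
          · exact (Nat.div_dvd_of_dvd hpr).trans (hre i)
          · exact Nat.Coprime.mul_dvd_of_dvd_of_dvd
              (Nat.coprime_comm.1 ((Nat.Prime.coprime_iff_not_dvd hp).2 hpr)) (hre i) hpe
        · rw [Function.update_of_ne hi]; exact hre i
      have htdr : ∀ i, d i ∣ Function.update r j (if p ∣ r j then r j / p else r j * p) i := by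
        intro i
        by_cases hi : i = j
        · subst hi
          rw [Function.update_self]
          split_ifs with hpr
          · have hcop : (d i).Coprime p :=
              Nat.coprime_comm.1 ((Nat.Prime.coprime_iff_not_dvd hp).2 hpd)
            exact hcop.dvd_of_dvd_mul_left (by rw [Nat.mul_comm, Nat.div_mul_cancel hpr]; exact hdr i)
          · exact (hdr i).mul_right p
        · rw [Function.update_of_ne hi]; exact hdr i
      exact Finset.mem_filter.2 ⟨mem_dkBoxP_of_dvd he htre, htdr, htre⟩
    · -- involutive
      intro r hr
      obtain ⟨-, -, hre⟩ := Finset.mem_filter.1 hr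
      funext i
      by_cases hi : i = j
      · subst hi
        simp only [Function.update_self]
        split_ifs with hpr h2 h3
        · exact absurd h2 (hndiv r hre hpr)
        · exact Nat.div_mul_cancel hpr
        · exact Nat.mul_div_cancel _ hp.pos
        · exact absurd (Dvd.intro_left _ rfl) h3
      · simp only [Function.update_of_ne hi]

/-! ### The inversion of (9.10) -/

/-- **Inversion of the change of variables (9.10)**: for admissible `𝓛` and `d ∈ dkBoxP`,
`λ_d/φ_L(d) = μ(d) ∑_{r ∈ dkBoxP, d ∣ r} y^{(m)}_r/φ_ω(r)`, i.e.
`λ_d = μ(d) φ_L(d) ∑_{d ∣ r} y^{(m)}_r/φ_ω(r)` («substituting this in (9.9)»).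
[cite: Maynard2016DenseClusters, proof of Prop. 9.2 p. 21, (9.10)–(9.11)] -/
theorem lamVar_div_totForm_eq {L : Fin k → ℤ × ℤ} (hadm : FormsAdmissible L) {B : ℕ} {R : ℝ}
    (F : (Fin k → ℝ) → ℝ) {m : Fin k} {d : Fin k → ℕ} (hd : d ∈ dkBoxP L B R m) :
    lamVar L B R F d / totForm (L m) (∏ i, d i) =
      ((μ (∏ i, d i) : ℤ) : ℝ) *
        ∑ r ∈ (dkBoxP L B R m).filter (fun r => ∀ i, d i ∣ r i),
          yVarM L B R F m r / phiOmega L (∏ i, r i) := by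
  classical
  have hφ : ∀ r ∈ dkBoxP L B R m, phiOmega L (∏ i, r i) ≠ 0 := fun r hr =>
    (phiOmega_prod_pos_of_mem_dkBox hadm (dkBoxP_subset L B R m hr)).ne'
  -- `y^{(m)}_r/φ_ω(r) = μ(r) ∑_{r ∣ e} λ_e/φ_L(e)`
  have h1 : ∀ r ∈ (dkBoxP L B R m).filter (fun r => ∀ i, d i ∣ r i),
      yVarM L B R F m r / phiOmega L (∏ i, r i) =
        ((μ (∏ i, r i) : ℤ) : ℝ) *
          ∑ e ∈ (dkBoxP L B R m).filter (fun e => ∀ i, r i ∣ e i),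
            lamVar L B R F e / totForm (L m) (∏ i, e i) := by
    intro r hr
    have hrP := (Finset.mem_filter.1 hr).1
    unfold yVarM
    rw [div_eq_iff (hφ r hrP)]
    ring
  rw [Finset.sum_congr rfl h1, Finset.sum_filter]
  -- expand to a double sum over the box and interchange
  have h2 : ∀ r ∈ dkBoxP L B R m,
      (if (∀ i, d i ∣ r i) then
          ((μ (∏ i, r i) : ℤ) : ℝ) *
            ∑ e ∈ (dkBoxP L B R m).filter (fun e => ∀ i, r i ∣ e i),
              lamVar L B R F e / totForm (L m) (∏ i, e i)
        else 0) =
        ∑ e ∈ dkBoxP L B R m,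
          (if ((∀ i, d i ∣ r i) ∧ ∀ i, r i ∣ e i) then ((μ (∏ i, r i) : ℤ) : ℝ) else 0) *
            (lamVar L B R F e / totForm (L m) (∏ i, e i)) := by
    intro r _
    by_cases hdr : ∀ i, d i ∣ r i
    · rw [if_pos hdr, Finset.sum_filter, Finset.mul_sum]
      refine Finset.sum_congr rfl fun e _ => ?_
      by_cases hre : ∀ i, r i ∣ e i
      · rw [if_pos hre, if_pos ⟨hdr, hre⟩]
      · rw [if_neg hre, if_neg (fun h => hre h.2), mul_zero, zero_mul]
    · rw [if_neg hdr]
      symm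
      refine Finset.sum_eq_zero fun e _ => ?_
      rw [if_neg (fun h => hdr h.1), zero_mul]
  rw [Finset.sum_congr rfl h2, Finset.sum_comm]
  have h3 : ∀ e ∈ dkBoxP L B R m,
      ∑ r ∈ dkBoxP L B R m,
          (if ((∀ i, d i ∣ r i) ∧ ∀ i, r i ∣ e i) then ((μ (∏ i, r i) : ℤ) : ℝ) else 0) *
            (lamVar L B R F e / totForm (L m) (∏ i, e i)) =
        if d = e then ((μ (∏ i, e i) : ℤ) : ℝ) * (lamVar L B R F e / totForm (L m) (∏ i, e i))
        else 0 := by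
    intro e he
    rw [← Finset.sum_mul, ← Finset.sum_filter, sum_moebius_interval_eq he d]
    split_ifs <;> simp
  rw [Finset.sum_congr rfl h3, Finset.sum_ite_eq, if_pos hd, ← mul_assoc]
  have hμ2 : ((μ (∏ i, d i) : ℤ) : ℝ) * ((μ (∏ i, d i) : ℤ) : ℝ) = 1 := by
    have h := ArithmeticFunction.moebius_sq_eq_one_of_squarefree
      (squarefree_of_mem_dkBox (dkBoxP_subset L B R m hd))
    rw [← pow_two]
    exact_mod_cast h
  rw [hμ2, one_mul]

/-- The inversion, multiplied out: `λ_d = φ_L(d) μ(d) ∑_{d ∣ r} y^{(m)}_r/φ_ω(r)` for `d ∈ dkBoxP`.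
[cite: Maynard2016DenseClusters, proof of Prop. 9.2 p. 21, (9.10)] -/
theorem lamVar_eq_totForm_mul {L : Fin k → ℤ × ℤ} (hadm : FormsAdmissible L) {B : ℕ} {R : ℝ}
    (F : (Fin k → ℝ) → ℝ) {m : Fin k} {d : Fin k → ℕ} (hd : d ∈ dkBoxP L B R m) :
    lamVar L B R F d =
      totForm (L m) (∏ i, d i) *
        (((μ (∏ i, d i) : ℤ) : ℝ) *
          ∑ r ∈ (dkBoxP L B R m).filter (fun r => ∀ i, d i ∣ r i),
            yVarM L B R F m r / phiOmega L (∏ i, r i)) := by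
  have hpos : 0 < totForm (L m) (∏ i, d i) := by
    refine totForm_pos (L m) (hadm.1 m) ?_
    rw [Finset.prod_ne_zero_iff]
    exact fun i _ => Nat.one_le_iff_ne_zero.1 (one_le_of_mem_dkBox (dkBoxP_subset L B R m hd) i)
  have h := lamVar_div_totForm_eq hadm F hd
  rw [div_eq_iff hpos.ne'] at h
  rw [h, mul_comm]

/-! ### Display (9.11) -/

/-- **[Maynard2016DenseClusters, display (9.11) p. 21]** (any `F`, admissible `𝓛`): substituting the
inversion of (9.10) into the quadratic form (9.9),
`∑'_{d,e ∈ dkBoxP} λ_d λ_e/φ_L([d,e]) = ∑_{r,s ∈ dkBoxP} (y^{(m)}_r y^{(m)}_s/(φ_ω(r) φ_ω(s))) T^{(m)}(r,s)`.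
[cite: Maynard2016DenseClusters, proof of Prop. 9.2 p. 21, (9.9)–(9.11); FordGreenKonyaginMaynardTao2018, Thm 6 (7.13)] -/
theorem primeQF_eq_sum_yVarM {L : Fin k → ℤ × ℤ} (hadm : FormsAdmissible L) (B : ℕ) (R : ℝ)
    (F : (Fin k → ℝ) → ℝ) (m : Fin k) :
    primeQF L B R F m =
      ∑ r ∈ dkBoxP L B R m, ∑ s ∈ dkBoxP L B R m,
        yVarM L B R F m r * yVarM L B R F m s / (phiOmega L (∏ i, r i) * phiOmega L (∏ i, s i)) *
          localPairSumM L B R m r s := by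
  classical
  unfold primeQF
  set box := dkBoxP L B R m with hbox
  -- the common 4-variable summand
  set g : (Fin k → ℕ) → (Fin k → ℕ) → (Fin k → ℕ) → (Fin k → ℕ) → ℝ := fun d e r s =>
    (if ∀ i j, i ≠ j → (d i * e i).Coprime (d j * e j) then
        ((μ (∏ i, d i) : ℤ) : ℝ) * ((μ (∏ i, e i) : ℤ) : ℝ) *
            (totForm (L m) (∏ i, d i) * totForm (L m) (∏ i, e i)) /
          totForm (L m) (∏ i, Nat.lcm (d i) (e i))
      else 0) *
      ((if ∀ i, d i ∣ r i then yVarM L B R F m r / phiOmega L (∏ i, r i) else 0) *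
        (if ∀ i, e i ∣ s i then yVarM L B R F m s / phiOmega L (∏ i, s i) else 0)) with hg
  -- LHS summand = ∑_r ∑_s g d e r s
  have hL : ∀ d ∈ box, ∀ e ∈ box,
      (if ∀ i j, i ≠ j → (d i * e i).Coprime (d j * e j) then
          lamVar L B R F d * lamVar L B R F e / totForm (L m) (∏ i, Nat.lcm (d i) (e i)) else 0) =
        ∑ r ∈ box, ∑ s ∈ box, g d e r s := by
    intro d hd e he
    have hSd : ∑ r ∈ box.filter (fun r => ∀ i, d i ∣ r i),
        yVarM L B R F m r / phiOmega L (∏ i, r i) =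
        ∑ r ∈ box, (if ∀ i, d i ∣ r i then yVarM L B R F m r / phiOmega L (∏ i, r i) else 0) :=
      Finset.sum_filter _ _
    have hSe : ∑ s ∈ box.filter (fun s => ∀ i, e i ∣ s i),
        yVarM L B R F m s / phiOmega L (∏ i, s i) =
        ∑ s ∈ box, (if ∀ i, e i ∣ s i then yVarM L B R F m s / phiOmega L (∏ i, s i) else 0) :=
      Finset.sum_filter _ _
    split_ifs with hP
    · rw [lamVar_eq_totForm_mul hadm F hd, lamVar_eq_totForm_mul hadm F he, hSd, hSe]
      simp only [hg, if_pos hP]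
      rw [sum_sum_const_mul_mul]
      ring
    · symm
      refine Finset.sum_eq_zero fun r _ => Finset.sum_eq_zero fun s _ => ?_
      simp only [hg, if_neg hP, zero_mul]
  -- RHS summand = ∑_d ∑_e g d e r s
  have hR : ∀ r ∈ box, ∀ s ∈ box,
      yVarM L B R F m r * yVarM L B R F m s / (phiOmega L (∏ i, r i) * phiOmega L (∏ i, s i)) *
          localPairSumM L B R m r s = ∑ d ∈ box, ∑ e ∈ box, g d e r s := by
    intro r _ s _
    unfold localPairSumM
    rw [Finset.sum_filter, Finset.mul_sum]
    refine Finset.sum_congr rfl fun d _ => ?_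
    split_ifs with hdr
    · rw [Finset.sum_filter, Finset.mul_sum]
      refine Finset.sum_congr rfl fun e _ => ?_
      split_ifs with hes hP
      · simp only [hg, if_pos hP, if_pos hdr, if_pos hes]; ring
      · simp only [hg, if_neg hP, zero_mul, mul_zero]
      · simp only [hg, if_neg hes, mul_zero]
    · rw [mul_zero]; symm
      refine Finset.sum_eq_zero fun e _ => ?_
      simp only [hg, if_neg hdr, zero_mul, mul_zero]
  rw [Finset.sum_congr rfl fun d hd => Finset.sum_congr rfl fun e he => hL d hd e he,
    Finset.sum_congr rfl fun r hr => Finset.sum_congr rfl fun s hs => hR r hr s hs]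
  -- ∑_d ∑_e ∑_r ∑_s = ∑_r ∑_s ∑_d ∑_e
  calc ∑ d ∈ box, ∑ e ∈ box, ∑ r ∈ box, ∑ s ∈ box, g d e r s
      = ∑ d ∈ box, ∑ r ∈ box, ∑ e ∈ box, ∑ s ∈ box, g d e r s :=
        Finset.sum_congr rfl fun d _ => Finset.sum_comm
    _ = ∑ r ∈ box, ∑ d ∈ box, ∑ e ∈ box, ∑ s ∈ box, g d e r s := Finset.sum_comm
    _ = ∑ r ∈ box, ∑ d ∈ box, ∑ s ∈ box, ∑ e ∈ box, g d e r s :=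
        Finset.sum_congr rfl fun r _ => Finset.sum_congr rfl fun d _ => Finset.sum_comm
    _ = ∑ r ∈ box, ∑ s ∈ box, ∑ d ∈ box, ∑ e ∈ box, g d e r s :=
        Finset.sum_congr rfl fun r _ => Finset.sum_comm

end Literature.NumberTheory.Sieve.FGKMT2018
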